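import Summits.QuantumAdvantage.AdviceFreeQNC0.WalkCoreHub
import Summits.QuantumAdvantage.AdviceFreeQNC0.CubeTransfer
import HarnessLib

/-!
# Cell qa-qnc0 (rung F-Q1, route RingFrame, crux α): E3 and W3 — walk rows are far under mixed
# hardness, hence `MixedHardPolylog → LDMAWalk` (planner qa-qnc0-p1 ROUND-9 §2, Sketch10 §22.2, ask P9)

Statements VERBATIM from `Sketch10.lean` §22.2 (`WalkRowFarOfMixedHard`, `LDMAWalkWith`, `LDMAWalk`,
`LDMAWalkOfMixedHard`) and PROVED:

* E3 `walkRowFar_of_mixedHardAt : WalkRowFarOfMixedHard` — under `MixedHardAt ℓ D θ` every walk row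
  `z = WIN_y` (degree `D`, any charge) has `distFail D z ≥ (1 − θ)·2^ℓ`: a nearest fail pattern is
  the complement of an even triple `P` (E1), and `dist(z, ¬P) = #{w : mixedWinU c' P y w = 0}
  ≥ 2^ℓ − θ2^ℓ`.
* W3 `ldmaWalk_of_mixedHardPolylog : LDMAWalkOfMixedHard` — `MixedHardPolylog → LDMAWalk` with
  `κ = (1 − θ)/4` (every walk row costs `≥ (1 − θ)2^{L'}`, a residue class has `≥ 2^L/4` rows for
  `L ≥ 3`, the total cost is `≤ 2^{L+L'}`); `mixedHardAt_antitone_deg` (antitone in the degree).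

WHAT THIS IS NOT: W1/W2 (the genuine rows ARE walk rows; `LDMAFam → WalkHardAll`) and E2/E6 are not
here; nothing on α or the separation.
-/

noncomputable section

namespace Summit.QuantumAdvantage.AdviceFreeQNC0

open Finset
open Literature.Computability.MetaComplexity Literature.Computability.MetaComplexity.Smolensky

/-! ### Vocabulary (verbatim from `Sketch10` §22.2) -/

/-- **E3**: walk rows are uniformly far under mixed hardness. -/
def WalkRowFarOfMixedHard : Prop :=
  ∀ ℓ D : ℕ, ∀ θ : ℝ, MixedHardAt ℓ D θ → ∀ c' : ℕ, ∀ z : (Fin ℓ → Bool) → Bool,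
    IsWalkRow c' D z → (1 - θ) * (2 : ℝ) ^ ℓ ≤ (distFail D z : ℝ)

/-- `LDMAWalkWith κ` — LDMA restricted to maps whose rows are walk win patterns of one charge. -/
def LDMAWalkWith (κ : ℝ) : Prop :=
  ∀ C : ℕ, ∃ L₀ : ℕ, ∀ L L' : ℕ, L₀ ≤ L → L₀ ≤ L' → ∀ D : ℕ, D ≤ (Nat.log 2 (min L L')) ^ C →
    ∀ c' : ℕ, ∀ Γ : (Fin L → Bool) → (Fin L' → Bool) → Bool,
      (∀ v, HasDeg (fun u => Γ u v) D) → (∀ u, IsWalkRow c' D (Γ u)) → ∀ r : ℕ,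
        κ * ((∑ u : Fin L → Bool, distFail D (Γ u) : ℕ) : ℝ) ≤
          ((∑ u ∈ cls L r, distFail D (Γ u) : ℕ) : ℝ)

/-- `LDMAWalk := ∃ κ > 0, LDMAWalkWith κ`. -/
def LDMAWalk : Prop := ∃ κ : ℝ, 0 < κ ∧ LDMAWalkWith κ

/-- **W3**: `MixedHardPolylog → LDMAWalk`. -/
def LDMAWalkOfMixedHard : Prop := MixedHardPolylog → LDMAWalk

/-! ### E3 -/

/-- **E3 `WalkRowFarOfMixedHard`.** -/
theorem walkRowFar_of_mixedHardAt : WalkRowFarOfMixedHard := by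
  intro ℓ D θ hM c' z hz
  classical
  obtain ⟨y, hy, hzy⟩ := hz
  obtain ⟨F, hF, hdF⟩ := exists_distFail_eq D z
  obtain ⟨P, ⟨hPdeg, hPeven⟩, hFP⟩ := (failCompl_iff_evenTriple ℓ D F).1 hF
  -- `dist(z, F) = #{w : mixedWinU c' P y w = false}`
  have hdist : hdist z F = (univ.filter fun w : Fin ℓ → Bool => mixedWinU c' P y w = false).card := by
    unfold hdist
    congr 1
    refine Finset.filter_congr fun w _ => ?_
    rw [hzy w, hFP w]
    unfold mixedWinU
    cases P (wt w % 3) w <;> cases ringWinU c' y w <;> decide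
  have hwin := hM c' P y hPdeg hPeven hy
  have htot := Finset.card_filter_add_card_filter_not
    (s := (univ : Finset (Fin ℓ → Bool))) (fun w => mixedWinU c' P y w = true)
  rw [Finset.card_univ, Fintype.card_fun, Fintype.card_bool, Fintype.card_fin] at htot
  have e : (univ.filter fun w : Fin ℓ → Bool => ¬ mixedWinU c' P y w = true) =
      univ.filter fun w : Fin ℓ → Bool => mixedWinU c' P y w = false := Finset.filter_congr fun w _ => by simp
  rw [e] at htot
  rw [← hdF, hdist]
  have hR : (((univ.filter fun w : Fin ℓ → Bool => mixedWinU c' P y w = false).card : ℕ) : ℝ) =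
      (2 : ℝ) ^ ℓ - ((univ.filter fun w : Fin ℓ → Bool => mixedWinU c' P y w = true).card : ℝ) := by
    have h := congrArg (fun n : ℕ => (n : ℝ)) htot
    push_cast at h
    linarith
  rw [hR]
  linarith

/-! ### W3 -/

/-- `MixedHardAt` is antitone in the degree. -/
theorem mixedHardAt_antitone_deg {ℓ D D' : ℕ} {θ : ℝ} (hDD : D ≤ D') (h : MixedHardAt ℓ D' θ) : MixedHardAt ℓ D θ :=
  fun c P y hP hPe hy => h c P y (fun r => hasDeg_of_le (hP r) hDD) hPe (fun g => hasDeg_of_le (hy g) hDD)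

/-- **W3 `LDMAWalkOfMixedHard`**: `MixedHardPolylog → LDMAWalk` with `κ = (1 − θ)/4`. -/
theorem ldmaWalk_of_mixedHardPolylog : LDMAWalkOfMixedHard := by
  rintro ⟨θ, hθ, hM⟩
  refine ⟨(1 - θ) / 4, by linarith, fun C => ?_⟩
  obtain ⟨ℓ₀, hℓ₀⟩ := hM C
  refine ⟨max ℓ₀ 3, fun L L' hL hL' D hD c' Γ _ hrows r => ?_⟩
  classical
  have hL3 : 3 ≤ L := le_trans (le_max_right _ _) hL
  have hL'ℓ : ℓ₀ ≤ L' := le_trans (le_max_left _ _) hL'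
  -- mixed hardness on Bob's `L'` bits at degree `D`
  have hDL' : D ≤ (Nat.log 2 L') ^ C :=
    hD.trans (Nat.pow_le_pow_left (Nat.log_mono_right (min_le_right L L')) C)
  have hMix : MixedHardAt L' D θ := mixedHardAt_antitone_deg hDL' (hℓ₀ L' hL'ℓ)
  -- each row costs at least `(1 − θ)2^{L'}`
  have hrow : ∀ u, (1 - θ) * (2 : ℝ) ^ L' ≤ (distFail D (Γ u) : ℝ) := fun u =>
    walkRowFar_of_mixedHardAt L' D θ hMix c' (Γ u) (hrows u)
  -- the class is large, the total is bounded
  have hcls := three_mul_card_cls_ge L r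
  have hL8 : (8 : ℝ) ≤ (2 : ℝ) ^ L := by
    calc (8 : ℝ) = 2 ^ 3 := by norm_num
      _ ≤ 2 ^ L := pow_le_pow_right₀ (by norm_num) hL3
  have htotal : ((∑ u : Fin L → Bool, distFail D (Γ u) : ℕ) : ℝ) ≤ (2 : ℝ) ^ L * (2 : ℝ) ^ L' := by
    have h1 : ∑ u : Fin L → Bool, distFail D (Γ u) ≤ ∑ _u : Fin L → Bool, 2 ^ L' :=
      Finset.sum_le_sum fun u _ => distFail_le_pow D (Γ u)
    rw [Finset.sum_const, Finset.card_univ, Fintype.card_fun, Fintype.card_bool, Fintype.card_fin,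
      smul_eq_mul] at h1
    exact_mod_cast h1
  have hclass : ((cls L r).card : ℝ) * ((1 - θ) * (2 : ℝ) ^ L') ≤ ((∑ u ∈ cls L r, distFail D (Γ u) : ℕ) : ℝ) := by
    push_cast
    rw [← nsmul_eq_mul, ← Finset.sum_const]
    exact Finset.sum_le_sum fun u _ => hrow u
  have h1θ : 0 ≤ 1 - θ := by linarith
  have h2L' : (0 : ℝ) ≤ (2 : ℝ) ^ L' := by positivity
  calc (1 - θ) / 4 * ((∑ u : Fin L → Bool, distFail D (Γ u) : ℕ) : ℝ)
      ≤ (1 - θ) / 4 * ((2 : ℝ) ^ L * (2 : ℝ) ^ L') := mul_le_mul_of_nonneg_left htotal (by positivity)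
    _ ≤ ((cls L r).card : ℝ) * ((1 - θ) * (2 : ℝ) ^ L') := by
        have : (2 : ℝ) ^ L / 4 ≤ ((cls L r).card : ℝ) := by linarith
        nlinarith [mul_nonneg h1θ h2L']
    _ ≤ ((∑ u ∈ cls L r, distFail D (Γ u) : ℕ) : ℝ) := hclass

end Summit.QuantumAdvantage.AdviceFreeQNC0

end
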